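import Literature.AlgebraicGeometry.GroupSchemes.CartierDualLagrangian
import HarnessLib

/-!
# A closed subgroup isotropic against another, of complementary rank, IS its annihilator («ANNIHILATOR by rank», block form)

Layer `Literature/AlgebraicGeometry/GroupSchemes`, namespace `Literature.AlgebraicGeometry.GroupSchemes.AffineGroupScheme` (continues ★
`CartierDualLagrangian` — the SELF-dual case `e : G ≅ G^D`, ONE subgroup, «isotropic of half rank ⟹ Lagrangian» — and ★
`CartierDualAnnihilatorOfDuality` — `ι ≫ e⁻¹ : Φ^⊥ ↪ G′` through a duality `e : G′ ≅ G^D` between TWO finite commutative group schemes, its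
points, the rank clause `rk Φ^⊥ · rk Φ = rk G′`).  THEOREMS ONLY (no definition, no named fact, no instance, no notation, no `sorry`).
Cell `hodgecm-mathlib`, programme P6 «MOD», organ (β)∕(E2-count) of F0P6b-plan (g3)'s MEMO-ED2 (LEAD F0P6-plan (g2) ruling 2026-09-01
20:52:23Z): the generic brick that closes the `w`-BLOCK Frobenius law of the junction `bigBlockFrobeniusLaw_of_heads`
(`Cruxes/HLiu418/Lines/F0_P6b_FrobeniusLagrangian.lean` ⊕ `…/F0_P6b_WeilCartierDuality.lean`: `Ker F ∩ W = (Ker F ∩ 𝒢l)^{⊥_{e_W}}` for the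
block duality `e_W : W ≅ 𝒢l^D`) onto a NAMED closed subgroup `Ψ ↪ W` from ONE inclusion and TWO ranks; `--supports stmt-HodgeConjecture-24832`,
count-neutral.

## Mathematics

Let `e : G′ ≅ G^D` be a perfect duality between finite commutative group schemes over a field `k` (Cartier: `G^D = Hom(G, 𝔾_m)`), `φ : Φ ↪ G`
a closed subgroup with annihilator `Φ^⊥ := ker φ^D ↪ G^D`, read in `G′` as the closed subgroup `ι ≫ e⁻¹ : Φ^⊥ ↪ G′`, and `ψ : Ψ ↪ G′` a
closed subscheme which is ISOTROPIC AGAINST `Φ` — `ψ` factors through `ι ≫ e⁻¹` (equivalently, when `ψ` is a homomorphism: the character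
`e ∘ ψ` restricted to `Φ` is trivial, `(ψ ≫ e) ≫ φ^D = 1`) — and of COMPLEMENTARY RANK, `rk G′ = rk Ψ · rk Φ`.  Then `Ψ = Φ^⊥` as subobjects
of `G′`: by the rank clause `rk Φ^⊥ · rk Φ = rk G′` ([Tate1997FiniteFlatGroupSchemes] §(3.8): Cartier duality is exact, ranks multiply) and
`rk Φ > 0`, `rk Φ^⊥ = rk Ψ`, so the factorisation `Ψ ↪ Φ^⊥` is a closed immersion of finite `k`-schemes of equal rank, hence an isomorphism
(★ `isIso_of_isClosedImmersion_of_finrank_alg_eq`).  In points: a `T`-point of `G′` lies in `Φ^⊥` iff it lies in `Ψ`.  The self-dual,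
one-subgroup case `G′ = G`, `Ψ = Φ` is ★ `CartierDualLagrangian`; the block case is how [MumfordAV1970] §23 (isotropic kernels of polarised
isogenies) is USED on one `p`-adic block of `A[q] ≅ A[q]^D` against its dual block ([Tate1997FiniteFlatGroupSchemes] §(3.8);
[Oda1969] Cor. 1.3 for `A[F] ⟂ A[F]`).

## Contents
* §1 `isClosedImmersion_left_of_fac_annihilatorι_comp_inv` (a factorisation of a closed immersion through `Φ^⊥ ↪ G′` is a closed immersion),
  `finrank_alg_annihilator_eq_of_finrank_alg_eq_mul'` (`rk G′ = r · rk Φ ⟹ rk Φ^⊥ = r`, the `G′`-form of ★ `finrank_alg_annihilator_eq_of_finrank_alg_eq_mul`),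
  **`isIso_of_fac_annihilatorι_comp_inv_of_finrank_mul`** (`Ψ ≅ Φ^⊥`).
* §2 **`exists_comp_annihilatorι_comp_inv_iff_of_fac_of_finrank_mul`** (points form: `x ∈ Φ^⊥ ↔ x ∈ Ψ`).
* §3 the pairing form for a closed subGROUP `ψ`: `exists_fac_annihilatorι_comp_inv_of_comp_cartierDualMap_eq_one`,
  **`exists_comp_annihilatorι_comp_inv_iff_of_comp_cartierDualMap_eq_one_of_finrank_mul`**.

## References
* [Tate1997FiniteFlatGroupSchemes] J. Tate, *Finite flat group schemes*, in Cornell–Silverman–Stevens (1997), §(3.7)–(3.8) pp. 145–146.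
* [MumfordAV1970] D. Mumford, *Abelian Varieties* (1970), §23 (descent of polarizations and isotropic subgroups).
* [Oda1969] T. Oda, *The first de Rham cohomology group and Dieudonné modules*, Ann. Sci. ÉNS (4) 2 (1969), Cor. 1.3.
* [Waterhouse1979] W. C. Waterhouse, *Introduction to Affine Group Schemes* (1979), §14.1.
-/

set_option autoImplicit false

-- Mathlib's `Over`/`Scheme` APIs are stated across semireducible wrappers (as in the ★ `GroupSchemes/*` files).
set_option backward.isDefEq.respectTransparency false

universe u

open CategoryTheory CategoryTheory.Limits AlgebraicGeometry MonoidalCategory CartesianMonoidalCategory WithConv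

noncomputable section

namespace Literature.AlgebraicGeometry.GroupSchemes

namespace AffineGroupScheme

open scoped MonObj

open Literature.AlgebraicGeometry.Motives GroupSchemeKernel

/-! ## §1 `Ψ ↪ Φ^⊥` is a closed immersion; complementary rank makes it an isomorphism -/

section Block

variable {k : Type u} [Field k] {Φ G G' Ψ : SchemeOver k}
  [GrpObj Φ] [IsCommMonObj Φ] [IsAffine Φ.left] [Module.Free k (Alg Φ)] [Module.Finite k (Alg Φ)]
  [GrpObj G] [IsCommMonObj G] [IsAffine G.left] [Module.Free k (Alg G)] [Module.Finite k (Alg G)]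
  [IsAffine Ψ.left] [Module.Finite k (Alg Ψ)]
  (φ : Φ ⟶ G) [IsMonHom φ] [IsClosedImmersion φ.left] (e : G' ≅ cartierDual G)
  (ψ : Ψ ⟶ G') [IsClosedImmersion ψ.left]

omit [Module.Free k (Alg G)] [Module.Finite k (Alg G)] [IsAffine Ψ.left] [Module.Finite k (Alg Ψ)] [IsClosedImmersion φ.left] in
/-- A factorisation `i : Ψ → Φ^⊥` of the closed immersion `ψ : Ψ ↪ G′` through `ι ≫ e⁻¹ : Φ^⊥ ↪ G′` is itself a closed immersion (closed
immersions cancel on the left of a closed immersion, Mathlib `IsClosedImmersion.of_comp`; ★ `isClosedImmersion_annihilatorι_comp_inv_left`).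
[cite: Tate1997FiniteFlatGroupSchemes, §(3.8) p. 146] -/
theorem isClosedImmersion_left_of_fac_annihilatorι_comp_inv (i : Ψ ⟶ annihilator φ) (hi : i ≫ (annihilatorι φ ≫ e.inv) = ψ) :
    IsClosedImmersion i.left := by
  haveI := isClosedImmersion_annihilatorι_comp_inv_left φ e
  haveI : IsClosedImmersion (i.left ≫ (annihilatorι φ ≫ e.inv).left) := by
    rw [← Over.comp_left, hi]
    infer_instance
  exact IsClosedImmersion.of_comp i.left (annihilatorι φ ≫ e.inv).left

omit [Module.Free k (Alg G)] [IsAffine Ψ.left] [Module.Finite k (Alg Ψ)] [IsClosedImmersion ψ.left] in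
include e in
/-- **`rk Γ(G′) = r · rk Γ(Φ) ⟹ rk Γ(Φ^⊥) = r`** — the `G′`-form of ★ `finrank_alg_annihilator_eq_of_finrank_alg_eq_mul` (★ rank clause
`rk Φ^⊥ · rk Φ = rk G′` through `e`, and `rk Φ > 0`). [cite: Tate1997FiniteFlatGroupSchemes, §(3.8) p. 145] -/
theorem finrank_alg_annihilator_eq_of_finrank_alg_eq_mul' {r : ℕ} (hr : Module.finrank k (Alg G') = r * Module.finrank k (Alg Φ)) :
    Module.finrank k (Alg (annihilator φ)) = r := by
  have h := finrank_alg_annihilator_mul_finrank_eq_of_iso φ e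
  rw [hr] at h
  exact Nat.eq_of_mul_eq_mul_right (finrank_alg_pos (H := Φ)) h

omit [Module.Free k (Alg G)] in
/-- **Isotropic against `Φ` of complementary rank ⟹ `Ψ ≅ Φ^⊥`**: if `ψ` factors as `i ≫ (ι ≫ e⁻¹)` through the annihilator of `Φ` and
`rk G′ = rk Ψ · rk Φ`, the factorisation `i : Ψ → Φ^⊥` is an ISOMORPHISM (`rk Φ^⊥ = rk Ψ` by §1, then ★ `isIso_of_isClosedImmersion_of_finrank_alg_eq`).
[cite: Tate1997FiniteFlatGroupSchemes, §(3.8) p. 146] [cite: MumfordAV1970, §23] -/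
theorem isIso_of_fac_annihilatorι_comp_inv_of_finrank_mul (i : Ψ ⟶ annihilator φ) (hi : i ≫ (annihilatorι φ ≫ e.inv) = ψ)
    (hrk : Module.finrank k (Alg G') = Module.finrank k (Alg Ψ) * Module.finrank k (Alg Φ)) : IsIso i := by
  haveI := isClosedImmersion_left_of_fac_annihilatorι_comp_inv φ e ψ i hi
  haveI : IsAffine (annihilator φ).left := isAffine_annihilator_left φ
  haveI : Module.Finite k (Alg (annihilator φ)) := finite_alg_annihilator φ
  have hann : Module.finrank k (Alg (annihilator φ)) = Module.finrank k (Alg Ψ) :=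
    finrank_alg_annihilator_eq_of_finrank_alg_eq_mul' φ e hrk
  exact isIso_of_isClosedImmersion_of_finrank_alg_eq i hann.symm

/-! ## §2 Points form: `x ∈ Φ^⊥ ↔ x ∈ Ψ` -/

omit [Module.Free k (Alg G)] in
/-- **ANNIHILATOR BY RANK (points form).**  Let `e : G′ ≅ G^D` be a duality between finite commutative group schemes over a field, `φ : Φ ↪ G`
a closed subgroup, `ψ : Ψ ↪ G′` a closed subscheme ISOTROPIC AGAINST `Φ` — `ψ = i ≫ (ι ≫ e⁻¹)` factors through `Φ^⊥ ↪ G′` — and of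
COMPLEMENTARY RANK, `rk G′ = rk Ψ · rk Φ`.  Then `Φ^⊥ = Ψ` inside `G′`: a `T`-point `x` of `G′` factors through `ι ≫ e⁻¹ : Φ^⊥ ↪ G′` iff it
factors through `ψ` — the shape of the `w`-block law `Ker F ∩ W = (Ker F ∩ 𝒢l)^{⊥_{e_W}}` read onto a named subgroup.
[cite: Tate1997FiniteFlatGroupSchemes, §(3.8) p. 146] [cite: MumfordAV1970, §23] [cite: Oda1969, Cor. 1.3] -/
theorem exists_comp_annihilatorι_comp_inv_iff_of_fac_of_finrank_mul (i : Ψ ⟶ annihilator φ)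
    (hi : i ≫ (annihilatorι φ ≫ e.inv) = ψ)
    (hrk : Module.finrank k (Alg G') = Module.finrank k (Alg Ψ) * Module.finrank k (Alg Φ))
    {T : SchemeOver k} (x : T ⟶ G') :
    (∃ c : T ⟶ annihilator φ, c ≫ (annihilatorι φ ≫ e.inv) = x) ↔ ∃ s : T ⟶ Ψ, s ≫ ψ = x := by
  haveI := isIso_of_fac_annihilatorι_comp_inv_of_finrank_mul φ e ψ i hi hrk
  constructor
  · rintro ⟨c, hc⟩
    have hψ : inv i ≫ ψ = annihilatorι φ ≫ e.inv := by
      rw [IsIso.inv_comp_eq]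
      exact hi.symm
    refine ⟨c ≫ inv i, ?_⟩
    rw [Category.assoc, hψ, hc]
  · rintro ⟨s, hs⟩
    refine ⟨s ≫ i, ?_⟩
    rw [Category.assoc, hi, hs]

end Block

/-! ## §3 The pairing form for a closed subGROUP `ψ`: `(ψ ≫ e) ≫ φ^D = 1` -/

section Pairing

variable {k : Type u} [Field k] {Φ G G' Ψ : SchemeOver k}
  [GrpObj Φ] [IsCommMonObj Φ] [IsAffine Φ.left] [Module.Free k (Alg Φ)] [Module.Finite k (Alg Φ)]
  [GrpObj G] [IsCommMonObj G] [IsAffine G.left] [Module.Free k (Alg G)] [Module.Finite k (Alg G)]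
  [GrpObj G'] [GrpObj Ψ] [IsAffine Ψ.left] [Module.Finite k (Alg Ψ)]
  (φ : Φ ⟶ G) [IsMonHom φ] [IsClosedImmersion φ.left] (e : G' ≅ cartierDual G)
  (ψ : Ψ ⟶ G') [IsClosedImmersion ψ.left]

omit [Module.Free k (Alg G)] [Module.Finite k (Alg G)] [GrpObj G'] [GrpObj Ψ] [IsAffine Ψ.left] [Module.Finite k (Alg Ψ)]
  [IsClosedImmersion φ.left] [IsClosedImmersion ψ.left] in
/-- **Isotropy as a factorisation.**  If the character `e ∘ ψ` of `G` is trivial on `Φ` — `(ψ ≫ e) ≫ φ^D = 1`, «`Ψ` and `Φ` pair trivially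
under `e`» — then `ψ` factors through `ι ≫ e⁻¹ : Φ^⊥ ↪ G′` (★ `kerLift` into `Φ^⊥ = ker φ^D`). [cite: Tate1997FiniteFlatGroupSchemes, §(3.8) p. 146] -/
theorem exists_fac_annihilatorι_comp_inv_of_comp_cartierDualMap_eq_one (h1 : (ψ ≫ e.hom) ≫ cartierDualMap φ = 1) :
    ∃ i : Ψ ⟶ annihilator φ, i ≫ (annihilatorι φ ≫ e.inv) = ψ := by
  refine ⟨kerLift (f := cartierDualMap φ) (ψ ≫ e.hom) h1, ?_⟩
  rw [← Category.assoc, annihilatorι_def, kerLift_ι, Category.assoc, Iso.hom_inv_id, Category.comp_id]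

omit [Module.Free k (Alg G)] [GrpObj G'] [GrpObj Ψ] in
/-- **ANNIHILATOR BY RANK, pairing form.**  `e : G′ ≅ G^D` a duality over a field, `φ : Φ ↪ G`, `ψ : Ψ ↪ G′` closed, with `(ψ ≫ e) ≫ φ^D = 1`
(`Ψ ⟂_e Φ`) and `rk G′ = rk Ψ · rk Φ` ⟹ a `T`-point of `G′` lies in `Φ^⊥` iff it lies in `Ψ`.
[cite: Tate1997FiniteFlatGroupSchemes, §(3.8) p. 146] [cite: MumfordAV1970, §23] -/
theorem exists_comp_annihilatorι_comp_inv_iff_of_comp_cartierDualMap_eq_one_of_finrank_mul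
    (h1 : (ψ ≫ e.hom) ≫ cartierDualMap φ = 1)
    (hrk : Module.finrank k (Alg G') = Module.finrank k (Alg Ψ) * Module.finrank k (Alg Φ))
    {T : SchemeOver k} (x : T ⟶ G') :
    (∃ c : T ⟶ annihilator φ, c ≫ (annihilatorι φ ≫ e.inv) = x) ↔ ∃ s : T ⟶ Ψ, s ≫ ψ = x := by
  obtain ⟨i, hi⟩ := exists_fac_annihilatorι_comp_inv_of_comp_cartierDualMap_eq_one φ e ψ h1
  exact exists_comp_annihilatorι_comp_inv_iff_of_fac_of_finrank_mul φ e ψ i hi hrk x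

end Pairing

end AffineGroupScheme

end Literature.AlgebraicGeometry.GroupSchemes

end
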